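/-
Copyright (c) 2026 the pub-hodgecm-mathlib formalisation cell (harness21).  Prover seat hodgecm-mathlib-K2E4-p23 (g0) (E4 base on loan to ENGINE E1), Track B ∕ K2-LIT,
h413 = `stmt-HodgeConjecture-24833`, campaign «EIS-WHITTAKER-3» (`U(2,1)`, CM `L ∕ L⁺`), block D-W2 · W2₃-arch, FILE B (dealer K2E1-plan (g5) 2026-09-04T08:13:29Z;
CONVENTIONS W0₃ 2fdd2f7063acaab9 §4 (v)): the factor `W_w(ξ,z) = 2π²·4^{1−z}·|δ|_w⁻¹·Γ(z)⁻²·𝓜[e^{−t−8π²|ξ|²∕t}](2z−2)` is ENTIRE in `z` (`ξ ≠ 0`), holomorphic on `{1 < Re z}` for every `ξ`,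
and decays like `e^{−2√2·π·|ξ|}` locally uniformly in `z`; products over the complex places.
-/
import Summits.HodgeConjecture.HodgeConjecture.Theorems.K2E1ArchWhittakerContinuation     -- ★ p858148: `differentiable_mellin_expKernel` :267, `norm_mellin_expKernel_le` :303 (kernel letters `e^{−t−A∕t}`)
import Summits.HodgeConjecture.HodgeConjecture.Theorems.K2E1ArchWhittakerDecayUniformU2     -- ★ p858464 (N = 2 twin): `re_mem_Icc_of_mem_closedBall`; brings ★ W4 `exists_exp_neg_mul_rpow_le_rpow_neg`, `Gamma.Deriv`
import HarnessLib

/-!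
# K2·E1 — `K2E1ArchWhittakerDecayUniformU3` («EIS-WHITTAKER-3», W2₃-arch, FILE B): continuation in `z` and the local uniform decay `e^{−2√2π|ξ|}` of the complex-place Whittaker factor

Track B ∕ K2-LIT, crux h413 = `stmt-HodgeConjecture-24833`, route of record `HCCMUnconditional`; cell `hodgecm-mathlib`, squad K2, ENGINE E1, campaign «EIS-WHITTAKER-3»
(dealer K2E1-plan (g5), DEALS memo fe56b7cd5d935977 §D-W2 (iii)–(iv); CONVENTIONS W0₃ 2fdd2f7063acaab9 §4 (v)).  Prover seat `hodgecm-mathlib-K2E4-p23` (g0).  THEOREMS ONLY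
(no `def`, no `instance`, no notation, no named-fact hypothesis, no `sorry`); lane `--supports stmt-HodgeConjecture-24833 --as helper` (count-neutral).  Closes no socket.
LETTERS FROZEN to FILE A `K2E1ArchWhittakerContinuationU3.integral_archWhittakerU3_eq` (`Re z > 1`): for `|δ|_w = dδ`, `ξ ∈ ℂ`, `z ∈ ℂ` the complex-place Whittaker factor is ALWAYS
spelled `2 * π ^ 2 * (4 : ℂ) ^ (1 - z) * (dδ : ℂ)⁻¹ * (Complex.Gamma z)⁻¹ ^ 2 * mellin (fun t : ℝ => Complex.exp (-(t : ℂ) - ((8 * π ^ 2 * ‖ξ‖ ^ 2 : ℝ) : ℂ) / (t : ℂ))) (2 * z - 2)`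
(`W_w(ξ,z)` in prose only); this file does not import FILE A (it needs only the closed form), so the two land independently.

THE MATHEMATICS [Bump1997, §3.7; Garrett2018, §1.10; the `N = 2` twins ★ p858148 §4–§5, ★ p858464].
* §5 CONTINUATION: `W_w(ξ,·)` is ENTIRE for `ξ ≠ 0` (`A = 8π²|ξ|² > 0`: ★ `differentiable_mellin_expKernel` ∘ `(z ↦ 2z − 2)`, `Γ⁻¹` and `4^{1−z}` entire) and holomorphic on the window
  `{1 < Re z}` for every `ξ` (`ξ = 0`: `𝓜[e^{−t}](2z−2) = GammaIntegral(2z−2)`, Mathlib `Complex.GammaIntegral_eq_mellin` ∕ `hasDerivAt_GammaIntegral`).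
* §6 STRIP BOUND ∕ DECAY: ★ :303 re-indexed to `0 < x₀ ≤ Re w ≤ x₁` (majorant `t^{x₀−1} + t^{x₁−1}`); `√A = 2√2·π·|ξ|`; for `1 < y₀ ≤ Re z ≤ y₁` the factor is bounded by
  `‖prefactor(z)‖·I(2y₀−2, 2y₁−2)·e^{−2√2π|ξ|}`; near every `z₀` with `Re z₀ > 1` (closed disc of radius `(Re z₀ − 1)∕2`, the entire prefactor bounded on it):
  **`‖W_w(ξ,z)‖ ≤ C_V·e^{−2√2·π·|ξ|}` for all `z ∈ V`, ALL `ξ ∈ ℂ`** (rate explicit), and the dealer's `∃ C b` letter.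
* §7 PRODUCTS over the complex places (`ι` finite, `dδ : ι → ℝ`, `ξ : ι → ℂ`): `C·e^{−Σ_i 2√2π|ξ_i|}`, sup-norm `C·e^{−2√2π‖ξ‖}` (the rate is the same at every complex place) and polynomial
  `M·(1+‖ξ‖)^{−k}` currencies (★ W4 `exists_exp_neg_mul_rpow_le_rpow_neg`); holomorphy of the products (entire if all `ξ_i ≠ 0`; on `{1 < Re z}` always) — the shapes W4₃∕W5₃ consume.
HONEST LABEL: HC_CM is proved only modulo the 7 printed citations (2 remaining named inputs: hLiu418 = `stmt-HodgeConjecture-24832`, h413 = `stmt-HodgeConjecture-24833`)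
until rung 0 closes; this file asserts no named fact and closes no socket.
References: [Bump1997] D. Bump, *Automorphic Forms and Representations* (1997), §1.6, §3.7 (archimedean Whittaker functions of Eisenstein series; `K`-Bessel decay) · [Garrett2018]
P. Garrett, *Modern Analysis of Automorphic Forms by Example* 1 (2018), §1.10.
-/

set_option autoImplicit false
-- the mandated namespace repeats the single-problem summit's segment (`HodgeConjecture.HodgeConjecture`)
set_option linter.dupNamespace false

noncomputable section

open MeasureTheory Filter Topology Set Real
open Summit.HodgeConjecture.HodgeConjecture.Cruxes.H413.K2E1ArchWhittakerContinuation (differentiable_mellin_expKernel norm_mellin_expKernel_le)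
open Summit.HodgeConjecture.HodgeConjecture.Cruxes.H413.K2E1ArchWhittakerDecayUniformU2 (re_mem_Icc_of_mem_closedBall)
open Summit.HodgeConjecture.HodgeConjecture.Cruxes.H413.K2E1WhittakerSeriesConvergenceU2 (exists_exp_neg_mul_rpow_le_rpow_neg)

namespace Summit.HodgeConjecture.HodgeConjecture.Cruxes.H413.K2E1ArchWhittakerDecayUniformU3

/-! ## §5  Continuation: entire for `ξ ≠ 0`, holomorphic on `{1 < Re z}` for every `ξ` -/

/-- **ENTIRE for `ξ ≠ 0`**: `z ↦ 2π²·4^{1−z}·|δ|_w⁻¹·Γ(z)⁻²·𝓜[e^{−t−8π²|ξ|²∕t}](2z−2)` is differentiable on all of `ℂ` (`A = 8π²|ξ|² > 0`: ★ `differentiable_mellin_expKernel` composed with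
`z ↦ 2z − 2`; `Γ⁻¹` and `4^{1−z}` entire) — the Whittaker factor, a priori an integral for `Re z > 1`, CONTINUES to an entire function. [cite: Bump1997, §1.6, §3.7] [cite: Garrett2018, §1.10] -/
theorem differentiable_archWhittakerU3 (dδ : ℝ) {ξ : ℂ} (hξ : ξ ≠ 0) :
    Differentiable ℂ fun z : ℂ => 2 * (π : ℂ) ^ 2 * (4 : ℂ) ^ (1 - z) * ((dδ : ℝ) : ℂ)⁻¹ * (Complex.Gamma z)⁻¹ ^ 2 *
      mellin (fun t : ℝ => Complex.exp (-(t : ℂ) - ((8 * π ^ 2 * ‖ξ‖ ^ 2 : ℝ) : ℂ) / (t : ℂ))) (2 * z - 2) := by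
  have hA : 0 < 8 * π ^ 2 * ‖ξ‖ ^ 2 := by have := norm_pos_iff.mpr hξ; positivity
  have h4 : Differentiable ℂ fun z : ℂ => (4 : ℂ) ^ (1 - z) := ((differentiable_const (1 : ℂ)).sub differentiable_id).const_cpow (Or.inl (by norm_num))
  have hΓ : Differentiable ℂ fun z : ℂ => (Complex.Gamma z)⁻¹ ^ 2 := Complex.differentiable_one_div_Gamma.pow 2
  have hM : Differentiable ℂ fun z : ℂ => mellin (fun t : ℝ => Complex.exp (-(t : ℂ) - ((8 * π ^ 2 * ‖ξ‖ ^ 2 : ℝ) : ℂ) / (t : ℂ))) (2 * z - 2) :=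
    (differentiable_mellin_expKernel hA).comp ((differentiable_id.const_mul _).sub_const _)
  exact ((((differentiable_const _).mul h4).mul (differentiable_const _)).mul hΓ).mul hM

/-- **HOLOMORPHIC ON THE WINDOW `{1 < Re z}` FOR EVERY `ξ`**: for `ξ ≠ 0` by the previous lemma; for `ξ = 0` the kernel is `e^{−t}`, `𝓜[e^{−t}](2z−2) = GammaIntegral(2z−2)` (Mathlib
`Complex.GammaIntegral_eq_mellin`), holomorphic where `Re(2z−2) > 0` (Mathlib `Complex.hasDerivAt_GammaIntegral`). [cite: Bump1997, §3.7] -/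
theorem differentiableOn_archWhittakerU3 (dδ : ℝ) (ξ : ℂ) :
    DifferentiableOn ℂ (fun z : ℂ => 2 * (π : ℂ) ^ 2 * (4 : ℂ) ^ (1 - z) * ((dδ : ℝ) : ℂ)⁻¹ * (Complex.Gamma z)⁻¹ ^ 2 *
      mellin (fun t : ℝ => Complex.exp (-(t : ℂ) - ((8 * π ^ 2 * ‖ξ‖ ^ 2 : ℝ) : ℂ) / (t : ℂ))) (2 * z - 2)) {z : ℂ | 1 < z.re} := by
  by_cases hξ : ξ = 0
  · subst hξ
    have hker : (fun t : ℝ => Complex.exp (-(t : ℂ) - ((8 * π ^ 2 * ‖(0 : ℂ)‖ ^ 2 : ℝ) : ℂ) / (t : ℂ))) = fun t : ℝ => ((Real.exp (-t) : ℝ) : ℂ) := by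
      funext t
      rw [Complex.ofReal_exp, Complex.ofReal_neg]
      congr 1
      simp
    have h4 : Differentiable ℂ fun z : ℂ => (4 : ℂ) ^ (1 - z) := ((differentiable_const (1 : ℂ)).sub differentiable_id).const_cpow (Or.inl (by norm_num))
    have hΓ : Differentiable ℂ fun z : ℂ => (Complex.Gamma z)⁻¹ ^ 2 := Complex.differentiable_one_div_Gamma.pow 2
    intro z hz
    have hz' : 0 < (2 * z - 2 : ℂ).re := by
      have : (2 * z - 2 : ℂ).re = 2 * z.re - 2 := by simp [Complex.mul_re]
      rw [this]
      have hz1 : 1 < z.re := hz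
      linarith
    have hmel : DifferentiableAt ℂ (fun w : ℂ => mellin (fun t : ℝ => Complex.exp (-(t : ℂ) - ((8 * π ^ 2 * ‖(0 : ℂ)‖ ^ 2 : ℝ) : ℂ) / (t : ℂ))) (2 * w - 2)) z := by
      have heq : (fun w : ℂ => mellin (fun t : ℝ => Complex.exp (-(t : ℂ) - ((8 * π ^ 2 * ‖(0 : ℂ)‖ ^ 2 : ℝ) : ℂ) / (t : ℂ))) (2 * w - 2)) =
          fun w : ℂ => Complex.GammaIntegral (2 * w - 2) := by
        funext w
        rw [hker, Complex.GammaIntegral_eq_mellin]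
      rw [heq]
      exact ((Complex.hasDerivAt_GammaIntegral hz').comp z (((hasDerivAt_id z).const_mul (2 : ℂ)).sub_const (2 : ℂ))).differentiableAt
    exact (((((differentiable_const _).mul h4).mul (differentiable_const _)).mul hΓ z).mul hmel).differentiableWithinAt
  · exact (differentiable_archWhittakerU3 dδ hξ).differentiableOn

/-! ## §6  Strip bound and local uniform decay `e^{−2√2·π·|ξ|}` -/

/-- **THE STRIP BOUND, RE-INDEXED** (`A ≥ 0`, `0 < x₀ ≤ Re w ≤ x₁`): `‖𝓜[e^{−t−A∕t}](w)‖ ≤ (∫_0^∞ (t^{x₀−1} + t^{x₁−1})·e^{−3t∕4} dt)·e^{−√A}` (★ :303 at `z = w + ½`). [cite: Bump1997, §3.7]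
[cite: Garrett2018, §1.10] -/
theorem norm_mellin_expKernel_le_of_re_pos {A x₀ x₁ : ℝ} (hA : 0 ≤ A) (hx₀ : 0 < x₀) {w : ℂ} (h₀ : x₀ ≤ w.re) (h₁ : w.re ≤ x₁) :
    ‖mellin (fun t : ℝ => Complex.exp (-(t : ℂ) - (A : ℂ) / (t : ℂ))) w‖ ≤
      (∫ t in Ioi (0 : ℝ), (t ^ (x₀ - 1) + t ^ (x₁ - 1)) * Real.exp (-(3 / 4 * t))) * Real.exp (-Real.sqrt A) := by
  have hre : (w + 1 / 2 : ℂ).re = w.re + 1 / 2 := by simp [Complex.add_re]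
  have h := norm_mellin_expKernel_le (A := A) (x₀ := x₀ + 1 / 2) (x₁ := x₁ + 1 / 2) hA (by linarith) (z := w + 1 / 2) (by rw [hre]; linarith)
    (by rw [hre]; linarith)
  rw [show (w + 1 / 2 : ℂ) - 1 / 2 = w by ring, show x₀ + 1 / 2 - 3 / 2 = x₀ - 1 by ring, show x₁ + 1 / 2 - 3 / 2 = x₁ - 1 by ring] at h
  exact h

/-- `√(8π²|ξ|²) = 2√2·π·|ξ|` — the decay exponent `√A_w(ξ)`. [folklore] -/
theorem sqrt_eight_pi_sq_mul_norm_sq (ξ : ℂ) : Real.sqrt (8 * π ^ 2 * ‖ξ‖ ^ 2) = 2 * Real.sqrt 2 * π * ‖ξ‖ := by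
  have h2 : Real.sqrt 2 ^ 2 = 2 := Real.sq_sqrt (by norm_num)
  rw [show 8 * π ^ 2 * ‖ξ‖ ^ 2 = (2 * Real.sqrt 2 * π * ‖ξ‖) ^ 2 by nlinarith [h2], Real.sqrt_sq (by positivity)]

/-- The strip integral `I(x₀,x₁) = ∫_0^∞ (t^{x₀−1} + t^{x₁−1})·e^{−3t∕4} dt` is `≥ 0`. [folklore] -/
theorem setIntegral_stripMajorant_nonneg' (x₀ x₁ : ℝ) : 0 ≤ ∫ t in Ioi (0 : ℝ), (t ^ (x₀ - 1) + t ^ (x₁ - 1)) * Real.exp (-(3 / 4 * t)) :=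
  setIntegral_nonneg measurableSet_Ioi fun t (ht : 0 < t) => by positivity

/-- **STRIP BOUND FOR THE WHITTAKER FACTOR** (`1 < y₀ ≤ Re z ≤ y₁`, every `ξ ∈ ℂ`):
`‖W_w(ξ,z)‖ ≤ ‖2π²·4^{1−z}·|δ|_w⁻¹·Γ(z)⁻²‖ · I(2y₀−2, 2y₁−2) · e^{−2√2·π·|ξ|}` (§6 re-indexed bound at `w = 2z − 2`, `A = 8π²|ξ|² ≥ 0`). [cite: Bump1997, §3.7] [cite: Garrett2018, §1.10] -/
theorem norm_archWhittakerU3_le_of_re_mem_Icc (dδ : ℝ) {y₀ y₁ : ℝ} (hy₀ : 1 < y₀) {z : ℂ} (h₀ : y₀ ≤ z.re) (h₁ : z.re ≤ y₁) (ξ : ℂ) :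
    ‖2 * (π : ℂ) ^ 2 * (4 : ℂ) ^ (1 - z) * ((dδ : ℝ) : ℂ)⁻¹ * (Complex.Gamma z)⁻¹ ^ 2 *
        mellin (fun t : ℝ => Complex.exp (-(t : ℂ) - ((8 * π ^ 2 * ‖ξ‖ ^ 2 : ℝ) : ℂ) / (t : ℂ))) (2 * z - 2)‖ ≤
      ‖2 * (π : ℂ) ^ 2 * (4 : ℂ) ^ (1 - z) * ((dδ : ℝ) : ℂ)⁻¹ * (Complex.Gamma z)⁻¹ ^ 2‖ *
        (∫ t in Ioi (0 : ℝ), (t ^ (2 * y₀ - 2 - 1) + t ^ (2 * y₁ - 2 - 1)) * Real.exp (-(3 / 4 * t))) * Real.exp (-(2 * Real.sqrt 2 * π * ‖ξ‖)) := by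
  have hre : (2 * z - 2 : ℂ).re = 2 * z.re - 2 := by simp [Complex.mul_re]
  have hm := norm_mellin_expKernel_le_of_re_pos (A := 8 * π ^ 2 * ‖ξ‖ ^ 2) (x₀ := 2 * y₀ - 2) (x₁ := 2 * y₁ - 2) (by positivity) (by linarith)
    (w := 2 * z - 2) (by rw [hre]; linarith) (by rw [hre]; linarith)
  rw [sqrt_eight_pi_sq_mul_norm_sq] at hm
  rw [norm_mul]
  exact (mul_le_mul_of_nonneg_left hm (norm_nonneg _)).trans_eq (mul_assoc _ _ _).symm

/-- **THE LOCAL UNIFORM DECAY AT ONE COMPLEX PLACE** (rate EXPLICIT): for `Re z₀ > 1` there are a neighbourhood `V` of `z₀` (the closed disc of radius `(Re z₀ − 1)∕2`) and `C ≥ 0` with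
`‖W_w(ξ,z)‖ ≤ C·e^{−2√2·π·|ξ|}` for all `z ∈ V` and ALL `ξ ∈ ℂ` (the entire prefactor is bounded on the compact disc; §6 strip bound). [cite: Bump1997, §3.7] [cite: Garrett2018, §1.10] -/
theorem exists_nhds_forall_norm_archWhittakerU3_le (dδ : ℝ) {z₀ : ℂ} (hz₀ : 1 < z₀.re) :
    ∃ V ∈ 𝓝 z₀, ∃ C : ℝ, 0 ≤ C ∧ ∀ z ∈ V, ∀ ξ : ℂ,
      ‖2 * (π : ℂ) ^ 2 * (4 : ℂ) ^ (1 - z) * ((dδ : ℝ) : ℂ)⁻¹ * (Complex.Gamma z)⁻¹ ^ 2 *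
          mellin (fun t : ℝ => Complex.exp (-(t : ℂ) - ((8 * π ^ 2 * ‖ξ‖ ^ 2 : ℝ) : ℂ) / (t : ℂ))) (2 * z - 2)‖ ≤
        C * Real.exp (-(2 * Real.sqrt 2 * π * ‖ξ‖)) := by
  set r : ℝ := (z₀.re - 1) / 2 with hr
  have hr0 : 0 < r := by rw [hr]; linarith
  have hy₀ : 1 < z₀.re - r := by rw [hr]; linarith
  -- the prefactor is entire, hence bounded on the compact disc
  have hP : Continuous fun z : ℂ => 2 * (π : ℂ) ^ 2 * (4 : ℂ) ^ (1 - z) * ((dδ : ℝ) : ℂ)⁻¹ * (Complex.Gamma z)⁻¹ ^ 2 := by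
    have h4 : Differentiable ℂ fun z : ℂ => (4 : ℂ) ^ (1 - z) := ((differentiable_const (1 : ℂ)).sub differentiable_id).const_cpow (Or.inl (by norm_num))
    have hΓ : Differentiable ℂ fun z : ℂ => (Complex.Gamma z)⁻¹ ^ 2 := Complex.differentiable_one_div_Gamma.pow 2
    exact ((((differentiable_const _).mul h4).mul (differentiable_const _)).mul hΓ).continuous
  obtain ⟨CP, hCP⟩ := (isCompact_closedBall z₀ r).exists_bound_of_continuousOn hP.continuousOn
  set I : ℝ := ∫ t in Ioi (0 : ℝ), (t ^ (2 * (z₀.re - r) - 2 - 1) + t ^ (2 * (z₀.re + r) - 2 - 1)) * Real.exp (-(3 / 4 * t)) with hI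
  have hI0 : 0 ≤ I := setIntegral_stripMajorant_nonneg' _ _
  refine ⟨Metric.closedBall z₀ r, Metric.closedBall_mem_nhds z₀ hr0, max CP 0 * I, mul_nonneg (le_max_right _ _) hI0, fun z hz ξ => ?_⟩
  obtain ⟨h₀, h₁⟩ := re_mem_Icc_of_mem_closedBall hz
  calc ‖2 * (π : ℂ) ^ 2 * (4 : ℂ) ^ (1 - z) * ((dδ : ℝ) : ℂ)⁻¹ * (Complex.Gamma z)⁻¹ ^ 2 *
          mellin (fun t : ℝ => Complex.exp (-(t : ℂ) - ((8 * π ^ 2 * ‖ξ‖ ^ 2 : ℝ) : ℂ) / (t : ℂ))) (2 * z - 2)‖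
        ≤ ‖2 * (π : ℂ) ^ 2 * (4 : ℂ) ^ (1 - z) * ((dδ : ℝ) : ℂ)⁻¹ * (Complex.Gamma z)⁻¹ ^ 2‖ * I * Real.exp (-(2 * Real.sqrt 2 * π * ‖ξ‖)) :=
          norm_archWhittakerU3_le_of_re_mem_Icc dδ hy₀ h₀ h₁ ξ
    _ ≤ max CP 0 * I * Real.exp (-(2 * Real.sqrt 2 * π * ‖ξ‖)) := by
          gcongr
          exact (hCP z hz).trans (le_max_left _ _)

/-- The dealer's letter (`∃ C b`): near `z₀` (`Re z₀ > 1`), `‖W_w(ξ,z)‖ ≤ C·e^{−b|ξ|}` for all `ξ` with SOME `b > 0` (namely `2√2·π`). [cite: Bump1997, §3.7] -/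
theorem exists_nhds_forall_norm_archWhittakerU3_le_exp_neg (dδ : ℝ) {z₀ : ℂ} (hz₀ : 1 < z₀.re) :
    ∃ V ∈ 𝓝 z₀, ∃ C b : ℝ, 0 ≤ C ∧ 0 < b ∧ ∀ z ∈ V, ∀ ξ : ℂ,
      ‖2 * (π : ℂ) ^ 2 * (4 : ℂ) ^ (1 - z) * ((dδ : ℝ) : ℂ)⁻¹ * (Complex.Gamma z)⁻¹ ^ 2 *
          mellin (fun t : ℝ => Complex.exp (-(t : ℂ) - ((8 * π ^ 2 * ‖ξ‖ ^ 2 : ℝ) : ℂ) / (t : ℂ))) (2 * z - 2)‖ ≤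
        C * Real.exp (-(b * ‖ξ‖)) := by
  obtain ⟨V, hV, C, hC0, hC⟩ := exists_nhds_forall_norm_archWhittakerU3_le dδ hz₀
  exact ⟨V, hV, C, 2 * Real.sqrt 2 * π, hC0, by positivity, hC⟩

/-! ## §7  The finitely many complex places: products, sup norm, both currencies, holomorphy -/

/-- **PRODUCT OVER THE COMPLEX PLACES** (`ι` finite, `|δ|_{w_i} = dδ_i`, `Re z₀ > 1`): there are `V ∈ 𝓝 z₀` and `C ≥ 0` with
`‖∏_i W_{w_i}(ξ_i,z)‖ ≤ C·e^{−Σ_i 2√2π|ξ_i|}` for all `z ∈ V`, `ξ : ι → ℂ` (`V = ⋂ V_i`, `C = ∏ C_i`, `Real.exp_sum`). [cite: Bump1997, §3.7] -/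
theorem exists_nhds_forall_norm_prod_archWhittakerU3_le {ι : Type*} [Fintype ι] (dδ : ι → ℝ) {z₀ : ℂ} (hz₀ : 1 < z₀.re) :
    ∃ V ∈ 𝓝 z₀, ∃ C : ℝ, 0 ≤ C ∧ ∀ z ∈ V, ∀ ξ : ι → ℂ,
      ‖∏ i, 2 * (π : ℂ) ^ 2 * (4 : ℂ) ^ (1 - z) * ((dδ i : ℝ) : ℂ)⁻¹ * (Complex.Gamma z)⁻¹ ^ 2 *
          mellin (fun t : ℝ => Complex.exp (-(t : ℂ) - ((8 * π ^ 2 * ‖ξ i‖ ^ 2 : ℝ) : ℂ) / (t : ℂ))) (2 * z - 2)‖ ≤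
        C * Real.exp (-(∑ i, 2 * Real.sqrt 2 * π * ‖ξ i‖)) := by
  classical
  choose V hV C hC0 hC using fun i => exists_nhds_forall_norm_archWhittakerU3_le (dδ i) hz₀
  refine ⟨⋂ i, V i, Filter.iInter_mem.2 hV, ∏ i, C i, Finset.prod_nonneg fun i _ => hC0 i, fun z hz ξ => ?_⟩
  have heq : (∏ i, C i) * Real.exp (-(∑ i, 2 * Real.sqrt 2 * π * ‖ξ i‖)) = ∏ i, (C i * Real.exp (-(2 * Real.sqrt 2 * π * ‖ξ i‖))) := by
    rw [Finset.prod_mul_distrib, ← Real.exp_sum, ← Finset.sum_neg_distrib]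
  rw [norm_prod, heq]
  exact Finset.prod_le_prod (fun i _ => norm_nonneg _) fun i _ => hC i z (Set.mem_iInter.mp hz i) (ξ i)

/-- The sup norm of `ξ : ι → ℂ` is at most the sum of the moduli of its entries. [folklore] -/
theorem pi_norm_le_sum_norm {ι : Type*} [Fintype ι] (ξ : ι → ℂ) : ‖ξ‖ ≤ ∑ i, ‖ξ i‖ := by
  refine (pi_norm_le_iff_of_nonneg (Finset.sum_nonneg fun i _ => norm_nonneg (ξ i))).2 fun i => ?_
  exact Finset.single_le_sum (fun j _ => norm_nonneg (ξ j)) (Finset.mem_univ i)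

/-- **EXPONENTIAL CURRENCY** (W5₃-A's `hWbd` shape): `‖∏_i W_{w_i}(ξ_i,z)‖ ≤ C·e^{−2√2π·‖ξ‖}` (sup norm of `ξ : ι → ℂ`) for `z ∈ V ∈ 𝓝 z₀`, `Re z₀ > 1` — the rate `2√2π` is the same at
every complex place. [cite: Bump1997, §3.7] [cite: Garrett2018, §1.10] -/
theorem exists_nhds_forall_norm_prod_archWhittakerU3_le_exp_neg_norm {ι : Type*} [Fintype ι] (dδ : ι → ℝ) {z₀ : ℂ} (hz₀ : 1 < z₀.re) :
    ∃ V ∈ 𝓝 z₀, ∃ C : ℝ, 0 ≤ C ∧ ∀ z ∈ V, ∀ ξ : ι → ℂ,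
      ‖∏ i, 2 * (π : ℂ) ^ 2 * (4 : ℂ) ^ (1 - z) * ((dδ i : ℝ) : ℂ)⁻¹ * (Complex.Gamma z)⁻¹ ^ 2 *
          mellin (fun t : ℝ => Complex.exp (-(t : ℂ) - ((8 * π ^ 2 * ‖ξ i‖ ^ 2 : ℝ) : ℂ) / (t : ℂ))) (2 * z - 2)‖ ≤
        C * Real.exp (-(2 * Real.sqrt 2 * π * ‖ξ‖)) := by
  obtain ⟨V, hV, C, hC0, hC⟩ := exists_nhds_forall_norm_prod_archWhittakerU3_le dδ hz₀
  refine ⟨V, hV, C, hC0, fun z hz ξ => (hC z hz ξ).trans (mul_le_mul_of_nonneg_left ?_ hC0)⟩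
  rw [Real.exp_le_exp, neg_le_neg_iff, ← Finset.mul_sum]
  exact mul_le_mul_of_nonneg_left (pi_norm_le_sum_norm ξ) (by positivity)

/-- **POLYNOMIAL CURRENCY** (W4₃'s `hWbd`): for every `k`, `‖∏_i W_{w_i}(ξ_i,z)‖ ≤ M·(1+‖ξ‖)^{−k}` for `z ∈ V ∈ 𝓝 z₀` (`Re z₀ > 1`) and every `ξ : ι → ℂ`
(★ W4 `exists_exp_neg_mul_rpow_le_rpow_neg`). [cite: Bump1997, §3.7] -/
theorem exists_nhds_forall_norm_prod_archWhittakerU3_le_rpow_neg {ι : Type*} [Fintype ι] (dδ : ι → ℝ) {z₀ : ℂ} (hz₀ : 1 < z₀.re) (k : ℝ) :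
    ∃ V ∈ 𝓝 z₀, ∃ M : ℝ, 0 ≤ M ∧ ∀ z ∈ V, ∀ ξ : ι → ℂ,
      ‖∏ i, 2 * (π : ℂ) ^ 2 * (4 : ℂ) ^ (1 - z) * ((dδ i : ℝ) : ℂ)⁻¹ * (Complex.Gamma z)⁻¹ ^ 2 *
          mellin (fun t : ℝ => Complex.exp (-(t : ℂ) - ((8 * π ^ 2 * ‖ξ i‖ ^ 2 : ℝ) : ℂ) / (t : ℂ))) (2 * z - 2)‖ ≤
        M * (1 + ‖ξ‖) ^ (-k) := by
  obtain ⟨V, hV, C, hC0, hC⟩ := exists_nhds_forall_norm_prod_archWhittakerU3_le_exp_neg_norm dδ hz₀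
  obtain ⟨M, hM0, hM⟩ := exists_exp_neg_mul_rpow_le_rpow_neg (b := 2 * Real.sqrt 2 * π) (by positivity) 0 k
  refine ⟨V, hV, C * M, mul_nonneg hC0 hM0, fun z hz ξ => (hC z hz ξ).trans ?_⟩
  have h := hM ‖ξ‖ (norm_nonneg ξ)
  rw [Real.rpow_zero, mul_one] at h
  calc C * Real.exp (-(2 * Real.sqrt 2 * π * ‖ξ‖)) ≤ C * (M * (1 + ‖ξ‖) ^ (-k)) := mul_le_mul_of_nonneg_left h hC0
    _ = C * M * (1 + ‖ξ‖) ^ (-k) := (mul_assoc _ _ _).symm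

/-- Products over the complex places are entire when all `ξ_i ≠ 0` (Mathlib `Differentiable.fun_finsetProd`). [cite: Bump1997, §3.7] -/
theorem differentiable_prod_archWhittakerU3 {ι : Type*} [Fintype ι] (dδ : ι → ℝ) {ξ : ι → ℂ} (hξ : ∀ i, ξ i ≠ 0) :
    Differentiable ℂ fun z : ℂ => ∏ i, 2 * (π : ℂ) ^ 2 * (4 : ℂ) ^ (1 - z) * ((dδ i : ℝ) : ℂ)⁻¹ * (Complex.Gamma z)⁻¹ ^ 2 *
      mellin (fun t : ℝ => Complex.exp (-(t : ℂ) - ((8 * π ^ 2 * ‖ξ i‖ ^ 2 : ℝ) : ℂ) / (t : ℂ))) (2 * z - 2) := by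
  classical
  exact Differentiable.fun_finsetProd fun i _ => differentiable_archWhittakerU3 (dδ i) (hξ i)

/-- Products over the complex places are holomorphic on the window `{1 < Re z}` for every `ξ` (Mathlib `DifferentiableOn.fun_finsetProd`). [cite: Bump1997, §3.7] -/
theorem differentiableOn_prod_archWhittakerU3 {ι : Type*} [Fintype ι] (dδ : ι → ℝ) (ξ : ι → ℂ) :
    DifferentiableOn ℂ (fun z : ℂ => ∏ i, 2 * (π : ℂ) ^ 2 * (4 : ℂ) ^ (1 - z) * ((dδ i : ℝ) : ℂ)⁻¹ * (Complex.Gamma z)⁻¹ ^ 2 *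
      mellin (fun t : ℝ => Complex.exp (-(t : ℂ) - ((8 * π ^ 2 * ‖ξ i‖ ^ 2 : ℝ) : ℂ) / (t : ℂ))) (2 * z - 2)) {z : ℂ | 1 < z.re} := by
  classical
  exact DifferentiableOn.fun_finsetProd fun i _ => differentiableOn_archWhittakerU3 (dδ i) (ξ i)

end Summit.HodgeConjecture.HodgeConjecture.Cruxes.H413.K2E1ArchWhittakerDecayUniformU3

end
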